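import Mathlib.NumberTheory.Padics.Hensel
import Mathlib.RingTheory.Polynomial.Basic
import HarnessLib

/-!
# The unit root of the Frobenius polynomial `X² − aX + p` of an ORDINARY elliptic curve (`p ∤ a`)

Topic `Literature/NumberTheory/PAdicHodge`; THEOREMS ONLY (no definition, no named fact, no instance, no `sorry`). Step 0 of the «eigen-frame»
road for Kato's reciprocity law on the (G)-ORDINARY K★ cells of crux `stmt-BirchSwinnertonDyer-22226` (line `kato_lever`, memo
`Cruxes/StarredOptimalManinUnitFiveSeven/Lines/kato-lever-seam-rec-at-cells.md` §6): for a good ORDINARY `ℤ`-model `E₀` at `p` (`a = a_p`,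
`p ∤ a`) the Honda / Dieudonné relation `φ²Λ − a·φΛ + p·Λ = 0` of the φ-road splits over `ℤ_p` along the two roots `α` (a UNIT) and
`β = a − α = p/α` of `X² − aX + p` — Hensel's lemma in `ℤ_p` at the approximate root `a` (`F(a) = p`, `F′(a) = a`).

* ★ `exists_unitRoot_frobeniusPoly` — `∃ α β : ℤ_p, ‖α‖ = 1 ∧ α² − aα + p = 0 ∧ α + β = a ∧ α·β = p`, for every `a ∈ ℤ_p` with `‖a‖ = 1`;
  `norm_eq_norm_p_of_mul_eq` — then `‖β‖ = ‖p‖ (< 1)`.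

## References
* N. M. Katz, *Crystalline cohomology, Dieudonné modules, and Jacobi sums* (1981), §5 (unit-root splitting). [Katz1981CrystallineDieudonne]
* J.-P. Serre, *A Course in Arithmetic* (1973), Ch. II §2 (Hensel's lemma). [Serre1973CourseArithmetic]
-/

noncomputable section

open Polynomial

namespace Literature.NumberTheory.PAdicHodge

variable {p : ℕ} [hp : Fact p.Prime]

/-- ★ **The unit root of `X² − aX + p` in `ℤ_p` for a unit `a`** (the ordinary case): `∃ α β`, `‖α‖ = 1`, `α² − aα + p = 0`, `α + β = a`,
`αβ = p`. Hensel's lemma (Mathlib `hensels_lemma`) at the approximate root `a`: `F(a) = p` has norm `< 1 = ‖F′(a)‖² = ‖a‖²`.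
[cite: Katz1981CrystallineDieudonne, §5] [cite: Serre1973CourseArithmetic, Ch. II §2 Thm. 1] -/
theorem exists_unitRoot_frobeniusPoly (a : ℤ_[p]) (ha : ‖a‖ = 1) :
    ∃ α β : ℤ_[p], ‖α‖ = 1 ∧ α ^ 2 - a * α + p = 0 ∧ α + β = a ∧ α * β = p := by
  set F : Polynomial ℤ_[p] := X ^ 2 - C a * X + C (p : ℤ_[p]) with hF
  have hFa : F.aeval a = p := by
    simp only [hF, map_add, map_sub, map_pow, map_mul, aeval_X, aeval_C]
    simp [sq]
  have hdF : F.derivative.aeval a = a := by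
    simp only [hF, derivative_add, derivative_X_pow, derivative_mul, derivative_C, derivative_X,
      zero_mul, zero_add, mul_one, map_sub, map_natCast]
    simp
    ring
  have hnorm : ‖F.aeval a‖ < ‖F.derivative.aeval a‖ ^ 2 := by
    rw [hFa, hdF, ha, one_pow, PadicInt.norm_p]
    exact inv_lt_one_of_one_lt₀ (by exact_mod_cast hp.out.one_lt)
  obtain ⟨α, hα0, hαa, -, -⟩ := hensels_lemma hnorm
  rw [hdF, ha] at hαa
  -- `‖α‖ = 1`: `α = a + (α − a)` with `‖α − a‖ < 1 = ‖a‖`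
  have hα1 : ‖α‖ = 1 := by
    have hne : ‖a‖ ≠ ‖α - a‖ := by rw [ha]; exact (ne_of_lt hαa).symm
    have h := PadicInt.norm_add_eq_max_of_ne hne
    rw [add_sub_cancel, ha] at h
    rw [h]
    exact max_eq_left hαa.le
  have hroot : α ^ 2 - a * α + p = 0 := by
    have h := hα0
    simp only [hF, map_add, map_sub, map_pow, map_mul, aeval_X, aeval_C] at h
    simpa using h
  refine ⟨α, a - α, hα1, hroot, by ring, ?_⟩
  linear_combination -hroot

/-- The companion root has norm `‖p‖` (so `< 1`): from `αβ = p` and `‖α‖ = 1`. [cite: Katz1981CrystallineDieudonne, §5] -/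
theorem norm_eq_norm_p_of_mul_eq {α β : ℤ_[p]} (hα : ‖α‖ = 1) (hαβ : α * β = p) : ‖β‖ = ‖(p : ℤ_[p])‖ := by
  have h := congrArg (‖·‖) hαβ
  simp only [norm_mul, hα, one_mul] at h
  exact h

end Literature.NumberTheory.PAdicHodge

end
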